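import Summits.Ventures.WeilGRH.TwistedFlatTestBounds
import Literature.Analysis.SpecialFunctions.DigammaReflection
import Mathlib.Analysis.SpecialFunctions.Trigonometric.ArctanDeriv
import Mathlib.MeasureTheory.Integral.IntegralEqImproper
import HarnessLib

/-!
# GRH arm (rh-explicit, venture WeilGRH): the archimedean constants of the flat-window inequality in
  CLOSED FORM — `K₀ = log 8π + γ + π/2`, `K₁ = log 8π + γ − π/2` (Odlyzko's `8πe^{γ±π/2}`)

Cell `rh-explicit`, WEIL TRACK (structure seat weil-3, gen8).  `TwistedFlatTestBounds.lean` bounded the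
constants of the flat-window inequality numerically (`K₀ ≥ 5.3716`, `K₁ = K₀ − π ≥ 2.23`).  Here the even
killing integral is EVALUATED:

  `∫₀^∞ (e^{t/2} − 1)/(2 sinh t) dt = (log 2)/2 + π/4`   (`integral_weilKillingDensityPar_zero`)

(substituting `u = e^{−t/2}`: the integrand is `u/((1+u)(1+u²))·(−2du/u)`-shaped and
`t ↦ −[log(1+u) + arctan u − ½log(1+u²)]` is a primitive; fundamental theorem of calculus on `(0, ∞)`),
whence the constants in closed form:

  `K₀ := log 4π + γ + 2∫₀^∞(e^{t/2} − 1)/(2 sinh t)dt = log 8π + γ + π/2 = 5.37218…`   (`flatWindow_const_zero_eq`),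
  `K₁ := log 4π + γ + 2∫₀^∞(e^{−t/2} − 1)/(2 sinh t)dt = log 8π + γ − π/2 = 2.23059…`  (`flatWindow_const_one_eq`),

equivalently `K₀ = log π − ψ(¼)`, `K₁ = log π − ψ(¾)` (Gauss's digamma values, `flatWindow_const_zero_eq_digamma`,
`…_one_eq_digamma`), and

  `e^{K₀} = 8π·e^γ·e^{π/2} = 215.33…`,   `e^{(K₀+K₁)/2} = 8π·e^γ = 44.76…`   (`exp_flatWindow_const_*`):

EXACTLY the Odlyzko–Serre GRH lower bounds for the root discriminant of totally real, resp. totally complex,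
number fields of large degree (Odlyzko 1976/77, Serre 1975, Poitou 1976/77) — the even character of the
GRH arm is a real-place `Γ_ℝ(s)` slot, an even+odd pair a complex place `Γ_ℂ(s) = Γ_ℝ(s)Γ_ℝ(s+1)`; the
`χ`-rung flat-window floors (`TwistedFlatTest.lean`) and their character-family sums
(`CharacterFamilyFlatTest.lean`, `3.8008 ≤ (K₀+K₁)/2`, `5.3716 ≤ K₀`) are the conductor-aspect form of the
Odlyzko discriminant inequalities, with these constants now exact.

No definitions, no named facts, RH/GRH-free.

## References

* A. M. Odlyzko, *Bounds for discriminants and related estimates for class numbers, regulators and zeros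
  of zeta functions: a survey of recent results*, Sém. Théor. Nombres Bordeaux 2 (1990) 119–141,
  (2.5)–(2.8). [Odlyzko1990Bounds]
* J.-P. Serre, *Minorations de discriminants* (note, October 1975), Œuvres III. [Serre1975Minorations]
* G. E. Andrews, R. Askey, R. Roy, *Special Functions* (1999), Thm. 1.2.7 (Gauss's `ψ(p/q)`).
  [AndrewsAskeyRoy1999]
-/

set_option autoImplicit false

noncomputable section

open Complex Filter Set MeasureTheory
open scoped Real Topology

namespace Summit.Ventures.WeilGRH

open Literature.NumberTheory.LFunctions

/-! ## A primitive of the even killing density -/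

/-- The derivative of `t ↦ −[log(1 + e^{−t/2}) + arctan(e^{−t/2}) − ½ log(1 + e^{−t})]`. -/
theorem hasDerivAt_killingPrimitive (t : ℝ) :
    HasDerivAt (fun t : ℝ ↦ -(Real.log (1 + Real.exp (-(t / 2))) + Real.arctan (Real.exp (-(t / 2))) -
        Real.log (1 + Real.exp (-t)) / 2))
      (Real.exp (-(t / 2)) / (2 * (1 + Real.exp (-(t / 2)))) +
        Real.exp (-(t / 2)) / (2 * (1 + Real.exp (-(t / 2)) ^ 2)) -
        Real.exp (-t) / (2 * (1 + Real.exp (-t)))) t := by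
  have hu : HasDerivAt (fun t : ℝ ↦ Real.exp (-(t / 2))) (Real.exp (-(t / 2)) * (-(1 / 2))) t :=
    ((hasDerivAt_id t).div_const 2).neg.exp
  have hv : HasDerivAt (fun t : ℝ ↦ Real.exp (-t)) (Real.exp (-t) * (-1)) t := (hasDerivAt_id t).neg.exp
  have h1pos : (1 : ℝ) + Real.exp (-(t / 2)) ≠ 0 := by positivity
  have h2pos : (1 : ℝ) + Real.exp (-t) ≠ 0 := by positivity
  have hlog1 := (hu.const_add 1).log h1pos
  have harc := hu.arctan
  have hlog2 := ((hv.const_add 1).log h2pos).div_const 2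
  refine HasDerivAt.congr_deriv ((hlog1.add harc).sub hlog2).neg ?_
  field_simp
  ring

/-- On `t > 0` that derivative IS the even killing density `(e^{t/2} − 1)/(2 sinh t)`
(with `v = e^{t/2} > 1`: both sides equal `v²/((v+1)(v²+1))`… after cancelling `v − 1`). -/
theorem killingPrimitive_deriv_eq {t : ℝ} (ht : 0 < t) :
    Real.exp (-(t / 2)) / (2 * (1 + Real.exp (-(t / 2)))) +
        Real.exp (-(t / 2)) / (2 * (1 + Real.exp (-(t / 2)) ^ 2)) -
        Real.exp (-t) / (2 * (1 + Real.exp (-t))) =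
      (Real.exp (t / 2) - 1) / (2 * Real.sinh t) := by
  set v : ℝ := Real.exp (t / 2) with hv
  have hv0 : 0 < v := Real.exp_pos _
  have hv1 : 1 < v := by rw [hv]; exact Real.one_lt_exp_iff.2 (by linarith)
  have hmt : Real.exp (-(t / 2)) = v⁻¹ := by rw [Real.exp_neg]
  have het : Real.exp t = v ^ 2 := by rw [hv, ← Real.exp_nat_mul]; congr 1; ring
  have hemt : Real.exp (-t) = (v ^ 2)⁻¹ := by rw [Real.exp_neg, het]
  have hsinh : Real.sinh t = (v ^ 2 - (v ^ 2)⁻¹) / 2 := by rw [Real.sinh_eq, het, hemt]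
  rw [hmt, hemt, hsinh]
  have hne : v - 1 ≠ 0 := by linarith
  have hne4 : v ^ 4 - 1 ≠ 0 := (sub_pos.2 (one_lt_pow₀ hv1 (by norm_num))).ne'
  -- both sides equal `v² / ((v + 1)(v² + 1))`
  have hL : v⁻¹ / (2 * (1 + v⁻¹)) + v⁻¹ / (2 * (1 + v⁻¹ ^ 2)) - (v ^ 2)⁻¹ / (2 * (1 + (v ^ 2)⁻¹)) =
      v ^ 2 / ((v + 1) * (v ^ 2 + 1)) := by
    field_simp
    ring
  have hR : (v - 1) / (2 * ((v ^ 2 - (v ^ 2)⁻¹) / 2)) = v ^ 2 / ((v + 1) * (v ^ 2 + 1)) := by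
    rw [show 2 * ((v ^ 2 - (v ^ 2)⁻¹) / 2) = (v - 1) * ((v + 1) * (v ^ 2 + 1)) / v ^ 2 by
      field_simp; ring]
    field_simp
  rw [hL, hR]

/-! ## The even killing integral, exactly -/

/-- **`∫₀^∞ (e^{t/2} − 1)/(2 sinh t) dt = (log 2)/2 + π/4`** (`= 1.13197…`; the parity-`0` killing integral
of the flat-window inequality; `= (ψ(½) − ψ(¼))/2`). -/
theorem integral_weilKillingDensityPar_zero :
    ∫ t in Ioi (0 : ℝ), weilKillingDensityPar 0 t = Real.log 2 / 2 + π / 4 := by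
  rw [show (fun t ↦ weilKillingDensityPar 0 t) = fun t ↦ (Real.exp (t / 2) - 1) / (2 * Real.sinh t) from
    funext weilKillingDensityPar_zero_eq]
  set F : ℝ → ℝ := fun t ↦ -(Real.log (1 + Real.exp (-(t / 2))) + Real.arctan (Real.exp (-(t / 2))) -
    Real.log (1 + Real.exp (-t)) / 2) with hF
  have hcont : ContinuousWithinAt F (Ici 0) 0 :=
    (hasDerivAt_killingPrimitive 0).continuousAt.continuousWithinAt
  have hderiv : ∀ t ∈ Ioi (0 : ℝ), HasDerivAt F ((Real.exp (t / 2) - 1) / (2 * Real.sinh t)) t :=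
    fun t ht ↦ (hasDerivAt_killingPrimitive t).congr_deriv (killingPrimitive_deriv_eq ht)
  have hlim : Tendsto F atTop (𝓝 0) := by
    -- `e^{−t/2} → 0`, `e^{−t} → 0`, and `F` is continuous in them with value `0` at `0`
    have h2 : Tendsto (fun t : ℝ ↦ Real.exp (-(t / 2))) atTop (𝓝 0) :=
      Real.tendsto_exp_neg_atTop_nhds_zero.comp (tendsto_id.atTop_div_const two_pos)
    have h1 : Tendsto (fun t : ℝ ↦ Real.exp (-t)) atTop (𝓝 0) := Real.tendsto_exp_neg_atTop_nhds_zero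
    have h10 : (1 : ℝ) + 0 ≠ 0 := by norm_num
    have hA : Tendsto (fun t : ℝ ↦ Real.log (1 + Real.exp (-(t / 2)))) atTop (𝓝 (Real.log (1 + 0))) :=
      (Real.continuousAt_log h10).tendsto.comp (h2.const_add 1)
    have hB : Tendsto (fun t : ℝ ↦ Real.arctan (Real.exp (-(t / 2)))) atTop (𝓝 (Real.arctan 0)) :=
      (Real.continuous_arctan.tendsto 0).comp h2
    have hC : Tendsto (fun t : ℝ ↦ Real.log (1 + Real.exp (-t)) / 2) atTop (𝓝 (Real.log (1 + 0) / 2)) :=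
      ((Real.continuousAt_log h10).tendsto.comp (h1.const_add 1)).div_const 2
    have h := ((hA.add hB).sub hC).neg
    rw [add_zero, Real.log_one, Real.arctan_zero, zero_div, add_zero, sub_zero, neg_zero] at h
    exact h
  rw [integral_Ioi_of_hasDerivAt_of_tendsto hcont hderiv integrableOn_weilKillingDensity hlim]
  simp only [hF, neg_zero, zero_div, Real.exp_zero, Real.arctan_one]
  have h2 : Real.log (1 + 1) = Real.log 2 := by norm_num
  rw [h2]
  ring

/-! ## The constants in closed form -/

/-- `log 4π + log 2 = log 8π`. -/
theorem log_four_pi_add_log_two : Real.log (4 * π) + Real.log 2 = Real.log (8 * π) := by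
  rw [← Real.log_mul (by positivity) (by norm_num)]
  congr 1
  ring

/-- **`K₀ = log 8π + γ + π/2`**: the archimedean constant of the flat-window inequality for EVEN characters
(and for `ζ`), in closed form.  `e^{K₀} = 8πe^{γ+π/2} = 215.33…` is Odlyzko's GRH discriminant constant for
totally real fields. -/
theorem flatWindow_const_zero_eq :
    Real.log (4 * π) + Real.eulerMascheroniConstant + 2 * ∫ t in Ioi (0 : ℝ), weilKillingDensityPar 0 t =
      Real.log (8 * π) + Real.eulerMascheroniConstant + π / 2 := by
  rw [integral_weilKillingDensityPar_zero, ← log_four_pi_add_log_two]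
  ring

/-- **`K₁ = log 8π + γ − π/2`**: the archimedean constant for ODD characters, in closed form
(`∫killing₁ = ∫killing₀ − π/2`, `TwistedFlatTestBounds`). -/
theorem flatWindow_const_one_eq :
    Real.log (4 * π) + Real.eulerMascheroniConstant + 2 * ∫ t in Ioi (0 : ℝ), weilKillingDensityPar 1 t =
      Real.log (8 * π) + Real.eulerMascheroniConstant - π / 2 := by
  rw [integral_weilKillingDensityPar_one_eq, integral_weilKillingDensityPar_zero, ← log_four_pi_add_log_two]
  ring

/-- **`K_κ` for every parity**: `K_κ = log 8π + γ + (π/2)(1 − 2κ)` for `κ = charParity χ ∈ {0, 1}`. -/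
theorem flatWindow_const_eq {q : ℕ} (χ : DirichletCharacter ℂ q) :
    Real.log (4 * π) + Real.eulerMascheroniConstant +
        2 * ∫ t in Ioi (0 : ℝ), weilKillingDensityPar (charParity χ) t =
      Real.log (8 * π) + Real.eulerMascheroniConstant + π / 2 * (1 - 2 * (charParity χ : ℝ)) := by
  have hκ := charParity_le_one χ
  interval_cases h : charParity χ
  · rw [flatWindow_const_zero_eq]; push_cast; ring
  · rw [flatWindow_const_one_eq]; push_cast; ring

/-- **`K₀ = log π − ψ(¼)`** (Gauss: `ψ(¼) = −γ − π/2 − 3 log 2`): the constant is the value at the central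
point of the archimedean part of `−Re L′/L`, `½[log(q/π) + ψ((s+κ)/2)]` doubled, for `κ = 0`. -/
theorem flatWindow_const_zero_eq_digamma :
    Real.log (4 * π) + Real.eulerMascheroniConstant + 2 * ∫ t in Ioi (0 : ℝ), weilKillingDensityPar 0 t =
      Real.log π - (Complex.digamma (1 / 4)).re := by
  rw [flatWindow_const_zero_eq, Literature.Analysis.SpecialFunctions.Complex.digamma_one_quarter_eq_neg_ofReal,
    Complex.neg_re, Complex.ofReal_re,
    show Real.log (8 * π) = 3 * Real.log 2 + Real.log π by
      rw [Real.log_mul (by norm_num) Real.pi_pos.ne', show (8 : ℝ) = 2 ^ 3 by norm_num, Real.log_pow]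
      push_cast; ring]
  ring

/-- **`K₁ = log π − ψ(¾)`** (Gauss: `ψ(¾) = −γ + π/2 − 3 log 2`), the odd companion. -/
theorem flatWindow_const_one_eq_digamma :
    Real.log (4 * π) + Real.eulerMascheroniConstant + 2 * ∫ t in Ioi (0 : ℝ), weilKillingDensityPar 1 t =
      Real.log π - (Complex.digamma (3 / 4)).re := by
  have h34 := congrArg Complex.re
    Literature.Analysis.SpecialFunctions.Complex.digamma_three_quarters_sub_digamma_one_quarter
  rw [Complex.sub_re, Complex.ofReal_re] at h34
  rw [flatWindow_const_one_eq, show (Complex.digamma (3 / 4)).re = (Complex.digamma (1 / 4)).re + π by linarith,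
    Literature.Analysis.SpecialFunctions.Complex.digamma_one_quarter_eq_neg_ofReal, Complex.neg_re,
    Complex.ofReal_re,
    show Real.log (8 * π) = 3 * Real.log 2 + Real.log π by
      rw [Real.log_mul (by norm_num) Real.pi_pos.ne', show (8 : ℝ) = 2 ^ 3 by norm_num, Real.log_pow]
      push_cast; ring]
  ring

/-! ## Odlyzko's constants -/

/-- **`e^{K₀} = 8π·e^γ·e^{π/2}`** (`= 215.33…`): the even constant exponentiated is the Odlyzko–Serre GRH
root-discriminant bound for totally real fields. -/
theorem exp_flatWindow_const_zero :
    Real.exp (Real.log (4 * π) + Real.eulerMascheroniConstant +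
        2 * ∫ t in Ioi (0 : ℝ), weilKillingDensityPar 0 t) =
      8 * π * Real.exp Real.eulerMascheroniConstant * Real.exp (π / 2) := by
  rw [flatWindow_const_zero_eq, Real.exp_add, Real.exp_add, Real.exp_log (by positivity)]

/-- **`e^{(K₀+K₁)/2} = 8π·e^γ`** (`= 44.76…`): the mean of the even and odd constants exponentiated is the
Odlyzko–Serre GRH root-discriminant bound for totally complex fields (one even + one odd slot per complex
place). -/
theorem exp_flatWindow_const_mean :
    Real.exp (((Real.log (4 * π) + Real.eulerMascheroniConstant +
          2 * ∫ t in Ioi (0 : ℝ), weilKillingDensityPar 0 t) +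
        (Real.log (4 * π) + Real.eulerMascheroniConstant +
          2 * ∫ t in Ioi (0 : ℝ), weilKillingDensityPar 1 t)) / 2) =
      8 * π * Real.exp Real.eulerMascheroniConstant := by
  rw [flatWindow_const_zero_eq, flatWindow_const_one_eq,
    show ((Real.log (8 * π) + Real.eulerMascheroniConstant + π / 2 +
        (Real.log (8 * π) + Real.eulerMascheroniConstant - π / 2)) / 2) =
      Real.log (8 * π) + Real.eulerMascheroniConstant by ring,
    Real.exp_add, Real.exp_log (by positivity)]

end Summit.Ventures.WeilGRH

end
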